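import Summits.Ventures.CertifiedManyBodySolver.Observables.PairLROTowerCeiling
import Summits.Ventures.CertifiedManyBodySolver.Observables.RungLeavesPairLROTTPrime
import HarnessLib

/-!
# The sharp one-point ceiling, consumers: orbit-state form, OP1-E certificate form, and the summit-format
# leaf at `c ≥ M²` (any `t'`)

HONEST FRAMING: first certified bounds on pairing observables; not a superconductivity verdict; every number
certified (two lineages + referee) or labelled float. Crew hubbard-obs (D-0042), seat hubbard-obs-p1
(`prover-hubbard-obs-p1-g5-0`). Zero compute; no definition; no named fact; no `sorry`.

The consumers of PairLROOnePointCeilingTT / RungLeavesPairLROTTPrime restated with the Koma–Tasaki tower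
reading `liminf_pairFieldLRO_le_sq_of_onePoint_variational_bound_TT'` (PairLROTowerCeiling) in place of the
two-sector one: SAME hypotheses (the OP1-E node shape is unchanged), conclusion with the constant `M²` in
place of `2M²`:
* `liminf_pairFieldLRO_le_sq_of_onePoint_orbitState_bound_TT'`,
* `liminf_pairFieldLRO_le_sq_of_onePoint_variational_certificate_TT'`,
* `dWavePairLRO_liminf_le_of_onePoint_variational_certificate_M3_sq`,
* **`M3ObsPairLROCeilingAt_of_onePoint_variational_certificate_sq`** — an OP1-E certificate with constant part
  `c₀ − Σ‖a_k‖ + (Σμ)(7/16 − ν) = −M` gives `M3ObsPairLROCeilingAt tp c` for every rational `c ≥ M²`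
  (e.g. `tp = 0`: the B0-class float `M = 0.7249` would read `c = 0.5254` instead of `1.0509`; planning only —
  no certificate of record exists).

References: T. Koma, H. Tasaki, J. Stat. Phys. 76 (1994) 745, Theorem 5 [KomaTasaki1994]; J. Wang et al.,
PRX 14 (2024) 031006, §III [WangEtAl2024]; X. Han, arXiv:2006.06002, §3 [Han2020Bootstrap]; D. J. Scalapino,
Phys. Rep. 250 (1995) 329, §2 eq. (2.4) [Scalapino1995]; O. Bratteli, D. W. Robinson, *Operator Algebras and
Quantum Statistical Mechanics 2* (1997), §6.2.4 [BratteliRobinsonII1997].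
-/

noncomputable section

namespace Summit.Ventures.CertifiedManyBodySolver.Observables

open Matrix Complex Finset Literature.MathematicalPhysics.QuantumLattice Literature.Probability.LatticeModels
open Literature.MathematicalPhysics.QuantumLattice.HubbardWave0 ThermodynamicLimit Filter Topology
open Literature.MathematicalPhysics.QuantumManyBody.StateRelaxation
open Summit.Ventures.CertifiedManyBodySolver.Transport
open scoped ComplexOrder ComplexConjugate BigOperators

section Family

variable (g : Site 2 → ℝ)

/-- **Orbit-state form, sharp constant.** As `liminf_pairFieldLRO_le_of_onePoint_orbitState_bound_TT'` but
with the Koma–Tasaki tower reading: conclusion `liminf u_k ≤ (c − A + (Σμ)(n/2 − ν))²` (no factor 2). [cite: KomaTasaki1994, Theorem 5]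
[cite: BratteliRobinsonII1997, §6.2.4] -/
theorem liminf_pairFieldLRO_le_sq_of_onePoint_orbitState_bound_TT' (t t' : ℝ) {U n : ℝ} (hU : 0 ≤ U)
    (hn0 : 0 ≤ n) (hn2 : n < 2) {c A κ u ν : ℝ} (μ : Fin 2 → ℝ) (hκ : 0 ≤ κ)
    (hu : energyDensityTT' t t' U n ≤ u)
    {S : Finset (DihedralGroup 4)} (hS : S.Nonempty)
    (hg : ∀ γ ∈ S, ∀ e ∈ insert (0 : Site 2) unitSteps, g (d4Vec γ e) = g e)
    {Λ' : Finset (Site 2)} (h0 : pairRegion (insert (0 : Site 2) unitSteps) 0 ⊆ Λ') (L₁ : ℕ)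
    (hInj : ∀ L : ℕ, L₁ ≤ L → Set.InjOn (Torus.proj (d := 2) L) ↑Λ')
    (hbound : ∀ (L : ℕ) [NeZero L] (hL : L₁ ≤ L) (ζ : Fock (Orb (FermionTorus 2 L))), star ζ ⬝ᵥ ζ = 1 →
      c - A + ∑ σ : Fin 2, μ σ *
          ((star ζ ⬝ᵥ ((∑ y : FermionTorus 2 L, numberOp y σ) *ᵥ ζ)).re / (L : ℝ) ^ 2 - ν) +
        κ * (u - (star ζ ⬝ᵥ (hubbardTorusTT' L t t' U *ᵥ ζ)).re / (L : ℝ) ^ 2) ≤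
        (orbitState (spaceGroupUnitary S) ζ (fermionEmbed (PolySite.toTorusEmb L (hInj L hL))
          (-(fermionEmbed (PolySite.incl h0) (localPairAt (insert (0 : Site 2) unitSteps) g 0))))).re)
    (ψ : ∀ L, Fock (Orb (FermionTorus 2 L)))
    (hψ : ∀ L, IsGroundStateInSector (hubbardTorusTT' L t t' U) (rectN n L) 0 (ψ L))
    (hψ1 : ∀ L, star (ψ L) ⬝ᵥ ψ L = 1) :
    liminf (fun k : ℕ => (∑ x ∈ halfOpenBox 2 (2 * k), ∑ y ∈ halfOpenBox 2 (2 * k),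
        torusPullback (pairFieldCorr g ψ) (2 * k) x y) / ((#(halfOpenBox 2 (2 * k)) : ℝ)) ^ 2) atTop ≤
      (c - A + (∑ σ : Fin 2, μ σ) * (n / 2 - ν)) ^ 2 := by
  refine liminf_pairFieldLRO_le_sq_of_onePoint_variational_bound_TT' g t t' hU hn0 hn2 μ hκ hu L₁ ?_ ψ hψ hψ1
  intro L _ hL ζ hζ
  have h := hbound L hL ζ hζ
  rwa [fermionEmbed_neg, map_neg, Complex.neg_re,
    re_orbitState_spaceGroupUnitary_localPairAt g hS hg h0 (hInj L hL) ζ] at h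

/-- **OP1-E window certificate ⇒ `liminf_k u_k ≤ M²` (sharp), `t–t'` model.** As
`liminf_pairFieldLRO_le_of_onePoint_variational_certificate_TT'` read through the tower: conclusion
`liminf u_k ≤ (c − Σ‖a_k‖ + (Σμ)(n/2 − ν))²` — HALF of the two-sector reading.
[cite: KomaTasaki1994, Theorem 5] [cite: WangEtAl2024, §III] [cite: Han2020Bootstrap, §3] -/
theorem liminf_pairFieldLRO_le_sq_of_onePoint_variational_certificate_TT' (t t' : ℝ) {U n : ℝ} (hU : 0 ≤ U)
    (hn0 : 0 ≤ n) (hn2 : n < 2) {κ u : ℝ} (hκ : 0 ≤ κ) (hu : energyDensityTT' t t' U n ≤ u)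
    {Λ Λ' : Finset (Site 2)} (hΛ : Λ ⊆ Λ')
    (h0 : thicken ({0} : Finset (Site 2)) 1 ⊆ Λ') (hz : (0 : Site 2) ∈ Λ')
    (hP : pairRegion (insert (0 : Site 2) unitSteps) 0 ⊆ Λ')
    {S : Finset (DihedralGroup 4)} (h1 : (1 : DihedralGroup 4) ∈ S) (hmul : ∀ a ∈ S, ∀ b ∈ S, a * b ∈ S)
    (hg : ∀ γ ∈ S, ∀ e ∈ insert (0 : Site 2) unitSteps, g (d4Vec γ e) = g e)
    (μ : Fin 2 → ℝ) (ν : ℝ)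
    {m : Type*} [Fintype m] [DecidableEq m] {Λm : Matrix m m ℂ} (hΛm : Λm.PosSemidef)
    (O : m → FermionOp Λ')
    {ι : Type*} (tt : Finset ι) (γ : ι → DihedralGroup 4) (hγS : ∀ l ∈ tt, γ l ∈ S) (wv : ι → Site 2)
    (hsh : ∀ l, d4ShiftSet (γ l) (wv l) Λ ⊆ Λ') (Y : ι → FermionOp Λ)
    {δ : Type*} (ah : Finset δ) (dc : δ → ℝ) (V : δ → FermionOp Λ')
    {κ'' : Type*} (w : Finset κ'') (a : κ'' → ℂ) (word : κ'' → List (Orb (PolySite Λ') × Bool)) {c : ℝ}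
    (hcert : -(fermionEmbed (PolySite.incl hP) (localPairAt (insert (0 : Site 2) unitSteps) g 0)) -
        (c : ℂ) • (1 : FermionOp Λ') -
        ∑ σ : Fin 2, ((μ σ : ℝ) : ℂ) • (nAt 0 hz σ - ((ν : ℝ) : ℂ) • (1 : FermionOp Λ')) -
        ((κ : ℝ) : ℂ) • (((u : ℝ) : ℂ) • (1 : FermionOp Λ') -
          fermionEmbed (PolySite.incl h0) ((hubbardTTPrimeFermionInteraction t t' U).meanEnergyObs 1)) =
      gramForm Λm O +
        ∑ l ∈ tt, (fermionEmbed (PolySite.incl (hsh l)) (fermionEmbed (PolySite.d4Emb (γ l) (wv l) Λ) (Y l)) -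
            fermionEmbed (PolySite.incl hΛ) (Y l)) +
        (∑ m' ∈ ah, ((dc m' : ℝ) : ℂ) • ((V m')ᴴ - V m') + ∑ k ∈ w, a k • ladderWord (word k)))
    (ψ : ∀ L, Fock (Orb (FermionTorus 2 L)))
    (hψ : ∀ L, IsGroundStateInSector (hubbardTorusTT' L t t' U) (rectN n L) 0 (ψ L))
    (hψ1 : ∀ L, star (ψ L) ⬝ᵥ ψ L = 1) :
    liminf (fun k : ℕ => (∑ x ∈ halfOpenBox 2 (2 * k), ∑ y ∈ halfOpenBox 2 (2 * k),
        torusPullback (pairFieldCorr g ψ) (2 * k) x y) / ((#(halfOpenBox 2 (2 * k)) : ℝ)) ^ 2) atTop ≤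
      (c - ∑ k ∈ w, ‖a k‖ + (∑ σ : Fin 2, μ σ) * (n / 2 - ν)) ^ 2 := by
  obtain ⟨L₀, hL₀⟩ := exists_forall_le_injOn_proj (d := 2) Λ'
  have hInj : ∀ L : ℕ, max L₀ 3 ≤ L → Set.InjOn (Torus.proj (d := 2) L) ↑Λ' :=
    fun L hL => hL₀ L (le_trans (le_max_left _ _) hL)
  refine liminf_pairFieldLRO_le_sq_of_onePoint_orbitState_bound_TT' g t t' hU hn0 hn2 μ hκ hu ⟨1, h1⟩ hg hP
    (max L₀ 3) hInj ?_ ψ hψ hψ1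
  intro L _ hL ζ hζ
  have hL3 : 3 ≤ L := le_trans (le_max_right _ _) hL
  exact re_orbitState_ge_of_window_variational_certificate_d4_TT'_ineq t t' U hL3 hΛ h0 hz (hInj L hL)
    h1 hmul hζ (-(fermionEmbed (PolySite.incl hP) (localPairAt (insert (0 : Site 2) unitSteps) g 0)))
    κ u μ ν hΛm O tt γ hγS wv hsh Y ah dc V w a word hcert

/-- **The registry-style reading at the M3 points `(U, n) = (8, 7/8)`, any `t'`, SHARP constant.** A point group `S ∋ 1`
closed under multiplication with `b1gSign = 1` on `S`; a window `Λ'` as above; the OP1-E identity for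
`X = −Γ(incl) Φ₀` (d-wave) with the local energy `E^{1,tp}_Φ` and `Λm ⪰ 0`; `κ ≥ 0`; the cap node
`M3EnergyUpperRow tp hi`, `hi ≤ u`; `(c − Σ‖a_k‖ + (Σ_σ μ_σ)(7/16 − ν))² ≤ c'` (no factor 2). Then every family `ψ_L`
of unit `(rectN (7/8) L, S^z = 0)`-sector ground states of `hubbardTorusTT' L 1 tp 8` has
`liminf_k |Λ_{2k}|⁻² Σ_{x,y} P_d(2k; x, y) ≤ c'` (at `tp = 0` this is `M3ObsPairLROCeilingAt_tp0 c'`;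
at `tp = −1/4` it is the one-point reading at the STEP-0 anchor A0). [cite: KomaTasaki1994, Theorem 5]
[cite: WangEtAl2024, §III] -/
theorem dWavePairLRO_liminf_le_of_onePoint_variational_certificate_M3_sq {tp : ℝ} {hi c' : ℚ}
    (hE : M3EnergyUpperRow tp hi) {κ u : ℝ} (hκ : 0 ≤ κ) (hhi : ((hi : ℚ) : ℝ) ≤ u)
    {Λ Λ' : Finset (Site 2)} (hΛ : Λ ⊆ Λ')
    (h0 : thicken ({0} : Finset (Site 2)) 1 ⊆ Λ') (hz : (0 : Site 2) ∈ Λ')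
    (hP : pairRegion (insert (0 : Site 2) unitSteps) 0 ⊆ Λ')
    {S : Finset (DihedralGroup 4)} (h1 : (1 : DihedralGroup 4) ∈ S) (hmul : ∀ a ∈ S, ∀ b ∈ S, a * b ∈ S)
    (hS1 : ∀ γ ∈ S, b1gSign γ = 1)
    (μ : Fin 2 → ℝ) (ν : ℝ)
    {m : Type*} [Fintype m] [DecidableEq m] {Λm : Matrix m m ℂ} (hΛm : Λm.PosSemidef)
    (O : m → FermionOp Λ')
    {ι : Type*} (tt : Finset ι) (γ : ι → DihedralGroup 4) (hγS : ∀ l ∈ tt, γ l ∈ S) (wv : ι → Site 2)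
    (hsh : ∀ l, d4ShiftSet (γ l) (wv l) Λ ⊆ Λ') (Y : ι → FermionOp Λ)
    {δ : Type*} (ah : Finset δ) (dc : δ → ℝ) (V : δ → FermionOp Λ')
    {κ'' : Type*} (w : Finset κ'') (a : κ'' → ℂ) (word : κ'' → List (Orb (PolySite Λ') × Bool)) {c : ℝ}
    (hcert : -(fermionEmbed (PolySite.incl hP) (localPairAt (insert (0 : Site 2) unitSteps) dWaveFormFactor 0)) -
        (c : ℂ) • (1 : FermionOp Λ') -
        ∑ σ : Fin 2, ((μ σ : ℝ) : ℂ) • (nAt 0 hz σ - ((ν : ℝ) : ℂ) • (1 : FermionOp Λ')) -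
        ((κ : ℝ) : ℂ) • (((u : ℝ) : ℂ) • (1 : FermionOp Λ') -
          fermionEmbed (PolySite.incl h0) ((hubbardTTPrimeFermionInteraction 1 tp 8).meanEnergyObs 1)) =
      gramForm Λm O +
        ∑ l ∈ tt, (fermionEmbed (PolySite.incl (hsh l)) (fermionEmbed (PolySite.d4Emb (γ l) (wv l) Λ) (Y l)) -
            fermionEmbed (PolySite.incl hΛ) (Y l)) +
        (∑ m' ∈ ah, ((dc m' : ℝ) : ℂ) • ((V m')ᴴ - V m') + ∑ k ∈ w, a k • ladderWord (word k)))
    (hc' : (c - ∑ k ∈ w, ‖a k‖ + (∑ σ : Fin 2, μ σ) * ((7 / 8 : ℝ) / 2 - ν)) ^ 2 ≤ ((c' : ℚ) : ℝ))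
    (ψ : ∀ L, Fock (Orb (FermionTorus 2 L)))
    (hψ : ∀ L, IsGroundStateInSector (hubbardTorusTT' L 1 tp 8) (rectN (7 / 8) L) 0 (ψ L))
    (hψ1 : ∀ L, star (ψ L) ⬝ᵥ ψ L = 1) :
    liminf (fun k : ℕ => (∑ x ∈ halfOpenBox 2 (2 * k), ∑ y ∈ halfOpenBox 2 (2 * k),
        torusPullback (pairFieldCorr dWaveFormFactor ψ) (2 * k) x y) /
          ((#(halfOpenBox 2 (2 * k)) : ℝ)) ^ 2) atTop ≤ ((c' : ℚ) : ℝ) := by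
  have hu : energyDensityTT' 1 tp 8 (7 / 8) ≤ u :=
    (show energyDensityTT' 1 tp 8 (7 / 8) ≤ ((hi : ℚ) : ℝ) from hE).trans hhi
  have hg : ∀ γ ∈ S, ∀ e ∈ insert (0 : Site 2) unitSteps, dWaveFormFactor (d4Vec γ e) = dWaveFormFactor e :=
    fun γ hγ e _ => dWaveFormFactor_d4Vec_of_b1gSign_eq_one (hS1 γ hγ) e
  exact (liminf_pairFieldLRO_le_sq_of_onePoint_variational_certificate_TT' dWaveFormFactor 1 tp (by norm_num)
    (by norm_num) (by norm_num) hκ hu hΛ h0 hz hP h1 hmul hg μ ν hΛm O tt γ hγS wv hsh Y ah dc V w a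
    word hcert ψ hψ hψ1).trans hc'


/-- **One OP1-E one-point certificate ⇒ the `t′`-generic summit-format leaf at the SHARP constant**:
`M3ObsPairLROCeilingAt tp c` for every rational `c ≥ (c₀ − Σ‖a_k‖ + (Σ_σ μ_σ)(7/16 − ν))²` (RungLeavesPairLROTTPrime
shape; at `tp = 0` it is `M3ObsPairLROCeilingAt_tp0 c` by `M3ObsPairLROCeilingAt_zero_iff`). [cite: KomaTasaki1994, Theorem 5] -/
theorem M3ObsPairLROCeilingAt_of_onePoint_variational_certificate_sq {tp : ℝ} {hi c : ℚ}
    (hE : M3EnergyUpperRow tp hi) {κ u : ℝ} (hκ : 0 ≤ κ) (hhi : ((hi : ℚ) : ℝ) ≤ u)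
    {Λ Λ' : Finset (Site 2)} (hΛ : Λ ⊆ Λ')
    (h0 : thicken ({0} : Finset (Site 2)) 1 ⊆ Λ') (hz : (0 : Site 2) ∈ Λ')
    (hP : pairRegion (insert (0 : Site 2) unitSteps) 0 ⊆ Λ')
    {S : Finset (DihedralGroup 4)} (h1 : (1 : DihedralGroup 4) ∈ S) (hmul : ∀ a ∈ S, ∀ b ∈ S, a * b ∈ S)
    (hS1 : ∀ γ ∈ S, b1gSign γ = 1)
    (μ : Fin 2 → ℝ) (ν : ℝ)
    {m : Type*} [Fintype m] [DecidableEq m] {Λm : Matrix m m ℂ} (hΛm : Λm.PosSemidef)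
    (O : m → FermionOp Λ')
    {ι : Type*} (tt : Finset ι) (γ : ι → DihedralGroup 4) (hγS : ∀ l ∈ tt, γ l ∈ S) (wv : ι → Site 2)
    (hsh : ∀ l, d4ShiftSet (γ l) (wv l) Λ ⊆ Λ') (Y : ι → FermionOp Λ)
    {δ : Type*} (ah : Finset δ) (dc : δ → ℝ) (V : δ → FermionOp Λ')
    {κ'' : Type*} (w : Finset κ'') (a : κ'' → ℂ) (word : κ'' → List (Orb (PolySite Λ') × Bool)) {c₀ : ℝ}
    (hcert : -(fermionEmbed (PolySite.incl hP) (localPairAt (insert (0 : Site 2) unitSteps) dWaveFormFactor 0)) -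
        (c₀ : ℂ) • (1 : FermionOp Λ') -
        ∑ σ : Fin 2, ((μ σ : ℝ) : ℂ) • (nAt 0 hz σ - ((ν : ℝ) : ℂ) • (1 : FermionOp Λ')) -
        ((κ : ℝ) : ℂ) • (((u : ℝ) : ℂ) • (1 : FermionOp Λ') -
          fermionEmbed (PolySite.incl h0) ((hubbardTTPrimeFermionInteraction 1 tp 8).meanEnergyObs 1)) =
      gramForm Λm O +
        ∑ l ∈ tt, (fermionEmbed (PolySite.incl (hsh l)) (fermionEmbed (PolySite.d4Emb (γ l) (wv l) Λ) (Y l)) -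
            fermionEmbed (PolySite.incl hΛ) (Y l)) +
        (∑ m' ∈ ah, ((dc m' : ℝ) : ℂ) • ((V m')ᴴ - V m') + ∑ k ∈ w, a k • ladderWord (word k)))
    (hc : (c₀ - ∑ k ∈ w, ‖a k‖ + (∑ σ : Fin 2, μ σ) * ((7 / 8 : ℝ) / 2 - ν)) ^ 2 ≤ ((c : ℚ) : ℝ)) :
    M3ObsPairLROCeilingAt tp c :=
  fun ψ hψ hψ1 => dWavePairLRO_liminf_le_of_onePoint_variational_certificate_M3_sq hE hκ hhi hΛ h0 hz hP h1
    hmul hS1 μ ν hΛm O tt γ hγS wv hsh Y ah dc V w a word hcert hc ψ hψ hψ1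

/-- **Registry consumer, orbit-state form at `t' = 0`, SHARP constant** — same hypotheses as
`M3ObsPairLROCeilingAt_tp0_of_onePoint_orbitState_bound` (PairLROOnePointReading: the shape in which the OP1-E
claim nodes of `Certificates/…obsOP1E…` are typed, `H_L = hubbardTorus 2 L 1 8`), conclusion at every rational
`c' ≥ (c − A + (Σ_σ μ_σ)(7/16 − ν))²` (no factor 2). [cite: KomaTasaki1994, Theorem 5] -/
theorem M3ObsPairLROCeilingAt_tp0_of_onePoint_orbitState_bound_sq {hi c' : ℚ} {c A κ u ν : ℝ}
    (μ : Fin 2 → ℝ) (hκ : 0 ≤ κ) (hE : M3EnergyUpperRow 0 hi) (hhi : ((hi : ℚ) : ℝ) ≤ u)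
    {S : Finset (DihedralGroup 4)} (hS : S.Nonempty) (hS1 : ∀ γ ∈ S, b1gSign γ = 1)
    {Λ' : Finset (Site 2)} (h0 : pairRegion (insert (0 : Site 2) unitSteps) 0 ⊆ Λ') (L₁ : ℕ)
    (hInj : ∀ L : ℕ, L₁ ≤ L → Set.InjOn (Torus.proj (d := 2) L) ↑Λ')
    (hbound : ∀ (L : ℕ) [NeZero L] (hL : L₁ ≤ L) (ζ : Fock (Orb (FermionTorus 2 L))), star ζ ⬝ᵥ ζ = 1 →
      c - A + ∑ σ : Fin 2, μ σ *
          ((star ζ ⬝ᵥ ((∑ y : FermionTorus 2 L, numberOp y σ) *ᵥ ζ)).re / (L : ℝ) ^ 2 - ν) +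
        κ * (u - (star ζ ⬝ᵥ (hubbardTorus 2 L 1 8 *ᵥ ζ)).re / (L : ℝ) ^ 2) ≤
        (orbitState (spaceGroupUnitary S) ζ (fermionEmbed (PolySite.toTorusEmb L (hInj L hL))
          (-(fermionEmbed (PolySite.incl h0)
            (localPairAt (insert (0 : Site 2) unitSteps) dWaveFormFactor 0))))).re)
    (hc' : (c - A + (∑ σ : Fin 2, μ σ) * ((7 / 8 : ℝ) / 2 - ν)) ^ 2 ≤ ((c' : ℚ) : ℝ)) :
    M3ObsPairLROCeilingAt_tp0 c' := by
  intro ψ hψ hψ1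
  have hu : energyDensityTT' 1 0 8 (7 / 8) ≤ u :=
    (show energyDensityTT' 1 0 8 (7 / 8) ≤ ((hi : ℚ) : ℝ) from hE).trans hhi
  have hg : ∀ γ ∈ S, ∀ e ∈ insert (0 : Site 2) unitSteps, dWaveFormFactor (d4Vec γ e) = dWaveFormFactor e :=
    fun γ hγ e _ => dWaveFormFactor_d4Vec_of_b1gSign_eq_one (hS1 γ hγ) e
  have hbound' : ∀ (L : ℕ) [NeZero L] (hL : L₁ ≤ L) (ζ : Fock (Orb (FermionTorus 2 L))), star ζ ⬝ᵥ ζ = 1 →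
      c - A + ∑ σ : Fin 2, μ σ *
          ((star ζ ⬝ᵥ ((∑ y : FermionTorus 2 L, numberOp y σ) *ᵥ ζ)).re / (L : ℝ) ^ 2 - ν) +
        κ * (u - (star ζ ⬝ᵥ (hubbardTorusTT' L 1 0 8 *ᵥ ζ)).re / (L : ℝ) ^ 2) ≤
        (orbitState (spaceGroupUnitary S) ζ (fermionEmbed (PolySite.toTorusEmb L (hInj L hL))
          (-(fermionEmbed (PolySite.incl h0)
            (localPairAt (insert (0 : Site 2) unitSteps) dWaveFormFactor 0))))).re := by
    intro L _ hL ζ hζ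
    rw [hubbardTorusTT'_zero]
    exact hbound L hL ζ hζ
  exact (liminf_pairFieldLRO_le_sq_of_onePoint_orbitState_bound_TT' dWaveFormFactor 1 0 (by norm_num)
    (by norm_num) (by norm_num) μ hκ hu hS hg h0 L₁ hInj hbound' ψ hψ hψ1).trans hc'

end Family

end Summit.Ventures.CertifiedManyBodySolver.Observables

end
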